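import Summits.BirchSwinnertonDyer.Rank1Residual.X11b.Three.ControlIdentityLocus
import Summits.BirchSwinnertonDyer.Rank1Residual.X11b.Three.OpenInputTight
import Summits.BirchSwinnertonDyer.Rank1Residual.X11b.Three.StepLAtThree
import HarnessLib

/-!
# X11b at `p = 3` (team `x11b3`, N8/O2): THE open input ⟺ `BSD(E,p)` from published + cited facts
# ALONE on the WHOLE Locus (X11b ∧ (ram) ∧ `p ∤ ∏c`), every odd `p` — the tightness theorems with
# their control hypothesis DISCHARGED and no side condition (sub-target T2-CTL3, part 4)

HONEST FRAMING (cell `b2b-bsdres`, run/shared/lean/b2b/bsd-rank1-residual/, verbatim in every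
file): the goal of the cell is to DELETE the COMBINATION-SHAPED residual classes of the
Birch–Swinnerton-Dyer formula for ALL analytic-rank `≤ 1` elliptic curves over `ℚ` — "full BSD
formula for every rank `≤ 1` curve in class `C`" assembled STRICTLY from published theorems — so
that the rank-`≤ 1` remainder becomes exactly the CONSTRUCTION-SHAPED classes, which are TYPED
(missing-input `Prop`s), NOT attempted. This is not "finishing BSD". Team `x11b3` (coordinator
ruling 2026-08-21T04:04Z) is a RESEARCH ROUTE; no claim beyond the stated class and locus; X11 ∧
`r = 1` at `p = 3` stays CONSTRUCTION-SHAPED / OPEN (RESIDUAL-MAP §I O2), X11b at `p ≥ 5` NEEDS (§I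
N8); nothing here changes a label; THEOREMS ONLY (no definition, no named fact, no `sorry`).

## What this file proves

`Three/ControlIdentityLocus` (part 3) proved the anticyclotomic control identity (Castella 2018 Thm.
2.3 / JSW 2017 Thm. 3.3.1 on the constructed `X_ac`) at EVERY Heegner datum of route p2 on the
WHOLE Locus X11b ∧ (ram) ∧ `p ∤ ∏_ℓ c_ℓ(E)`, every odd `p`, from Kolyvagin and the four cited
cohomological facts (`p2ControlOnTree_odd_of_locus`, `p2ControlOnTreeAt_of_locus`). Feeding it to
the tightness theorems of route p2 (multr1-p2 gen 18, `p ≥ 5`) and of this team (x11b3-p7, odd `p`)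
removes their ONLY non-published hypothesis besides the open input:

* §1 **`P2.openInputOnTreeOddAt_iff_bsdp_of_locus_of_facts`** — every odd `p`, on the Locus: THE open
  input ⟺ `BSD(E,p)` from the twelve published facts of route p2 + route R1's three further cited
  cohomological facts, NOTHING ELSE; `P2.openInputOnTreeOddAt_of_bsdp_of_locus_of_facts` (validation
  direction); `P2.openInputOnTreeAt_iff_bsdp_of_locus_of_facts` — multr1-p2's gen-18 tightness
  (`p ≥ 5`; class-wide 2 093 111 Locus pairs) with its `hC` discharged.
* §2 the `p = 3` rows: `P2.openInputOnTreeOddAt_three_iff_bsdp_of_locus_of_facts` (census3 atom A1: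
  248 943 class-pairs `N < 5·10⁵`; sweep TRUE OPEN ∩ A1 = 1 116 of 1 684 classes; lane
  CLOSABLE:T-SEL3 ∩ A1 = 1 216 classes where the open input then HOLDS as a consequence of the
  certified `BSD(E,3)`), the SEMISTABLE form ((ram) automatic: 100 315 class-pairs), and
  **`Three.stepLAt_iff_bsdp_of_locus`**: the team's typed STEP-L-at-3 conjecture `Three.StepLAt W`
  (x11b3-p1) is EQUIVALENT to `BSD(E,3)` on all of A1, facts only — on A1 statement discovery (E1) can
  neither weaken nor strengthen the typed target, only find its SOURCE.

What this is NOT: THE open input (IMC≥)∘(BDP) is untouched at every `p`; nothing booked; off the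
Locus ((T2′): `p ∣ ∏c`; (T4″) corner) nothing is claimed; 0 facts minted.

References: [Castella2018] Thm. 2.3 (arXiv:1704.06608 p. 5), Thm. 3.2 (p. 9); [Castella2018Erratum]
(2.4); [JetchevSkinnerWan2017] §2 (p. 6 L9 "p ≥ 3"), Thm. 3.3.1, Prop. 3.2.1, Lemma 3.3.3, Prop. 3.3.4,
§7.4.1–7.4.3 (arXiv:1512.06894 pp. 10–13, 30–31); [GreenbergLNM1716] §3 Lemma 3.3 (p. 87);
[Skinner2016PacificMC] Thm. C; [Wuthrich2014] Prop. 21; [Kolyvagin1990] Thm. A; [MilneADT2006] I 2.8,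
I 4.10; [Miller2011LMS] Def. 1.1.
-/

noncomputable section

open scoped Classical

open WeierstrassCurve NumberField IsDedekindDomain Field
  Literature.NumberTheory.EllipticCurves Literature.NumberTheory.EllipticCurves.GreenbergSelmer
  Literature.NumberTheory.EllipticCurves.ModularForms Literature.NumberTheory.EllipticCurves.Rank1Residual
  Literature.NumberTheory.EllipticCurves.Rank1Residual.Typed Literature.NumberTheory.EllipticCurves.Wuthrich2014
  Literature.NumberTheory.GaloisRepresentations Literature.NumberTheory.GaloisCohomology
  Summit.BirchSwinnertonDyer.Rank1Residual.X11b.AcSelmer Summit.BirchSwinnertonDyer.Rank1Residual.X11b.LocBridge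

namespace Summit.BirchSwinnertonDyer.Rank1Residual.X11b

/-! ## §1. Tightness of THE open input on the whole Locus from published + cited facts ALONE -/

section Tight

variable (W : WeierstrassCurve ℚ) [W.IsElliptic] [W.IsGloballyMinimal] (p : ℕ) [Fact p.Prime]

/-- **THE OPEN INPUT (odd form) ⟺ `BSD(E,p)` ON THE WHOLE LOCUS (X11b ∧ (ram) ∧ `p ∤ ∏_ℓ c_ℓ(E)`),
EVERY ODD `p`, from published + cited facts ALONE**: x11b3-p7's `P2.openInputOnTreeOddAt_iff_bsdp_of_locus`
with its control hypothesis discharged by `Three/ControlIdentityLocus` (`p2ControlOnTree_odd_of_locus`) — inputs are the twelve published facts of route p2 and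
route R1's three further cited cohomological facts, NOTHING ELSE (no control, Selmer, local or
side-condition binder). On the Locus the literature is asked EXACTLY `BSD(E,p)`'s worth, pair by
pair. CONDITIONAL bookkeeping; nothing booked; X11b stays CONSTRUCTION-SHAPED (O2 OPEN / N8 NEEDS).
[cite: Castella2018, Thm. 2.3 (p. 5), Thm. 3.2 (p. 9)] [cite: Castella2018Erratum, (2.4) (p. 1)]
[cite: JetchevSkinnerWan2017, Thm. 3.3.1, Prop. 3.2.1, Lemma 3.3.3, Prop. 3.3.4 (pp. 10–13), §7.4.1–7.4.3 (pp. 30–31)]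
[cite: Skinner2016PacificMC, Thm. C (§1) and footnote 1] [cite: GreenbergLNM1716, §3 Lemma 3.3 (p. 87)] [cite: Miller2011LMS, Def. 1.1] -/
theorem P2.openInputOnTreeOddAt_iff_bsdp_of_locus_of_facts
    (hGZ : ∀ (N : ℕ) [NeZero N] (W : WeierstrassCurve ℚ) (K : Type) [Field K] [NumberField K],
      gross_zagier N W K)
    (hKo : ∀ (N : ℕ) [NeZero N] (W : WeierstrassCurve ℚ) (K : Type) [Field K] [NumberField K],
      kolyvagin N W K)
    (hB : ∀ (N : ℕ) [NeZero N] (W : WeierstrassCurve ℚ) (K : Type) [Field K] [NumberField K],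
      Kolyvagin1990_padicValNat_card_sha_le N W K)
    (hSk : Skinner2016.thmC_padicValRat_bsd_rank_zero) (hWu : sha_dvd_analyticSha)
    (hGZK : rank_eq_analyticRank_of_analyticRank_le_one) (hmod : hasEntireLFunction_rat)
    (hnf : exists_isNewformOf) (hHL : HoffsteinLuo1997_exists_twist_L_one_ne_zero)
    (hMaz : mazur_not_dvd_maninConstant_of_odd)
    (hPT : ∀ (K : Type) [Field K] [NumberField K], poitouTate_sum_localTatePairing_eq_zero K)
    (hEP : ∀ (K : Type) [Field K] [NumberField K] (v : HeightOneSpectrum (𝓞 K)),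
      localEulerPoincareCharacteristic (v.adicCompletion K))
    (hPTs : ∀ (K : Type) [Field K] [NumberField K], poitouTate_selmerStructure_duality K)
    (hPT2 : ∀ (K : Type) [Field K] [NumberField K], poitouTate_sha_tateDual K)
    (hcd : fieldCdLE_two_of_numberField)
    (hX : ClassX11b W p) (hram : Ram W p) (htam : ¬ p ∣ W.tamagawaProduct) :
    P2OpenInputOnTreeOddAt W p ↔ BSDp W p :=
  P2.openInputOnTreeOddAt_iff_bsdp_of_locus W p hGZ hKo hB hSk hWu hGZK hmod hnf hHL hMaz hPT hEP
    (p2ControlOnTree_odd_of_locus W p hKo hPTs hPT2 hEP hcd hX hram htam) hX hram htam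

/-- **`BSD(E,p)` ⟹ THE OPEN INPUT on the whole Locus, facts only, every odd `p`** (validation
direction: every certificate-closed pair of the Locus satisfies THE open input at every Heegner datum
route p2 quantifies over). [cite: Castella2018, Thm. 2.3 (p. 5), Thm. 3.2 (p. 9), (1.1) (p. 2)]
[cite: JetchevSkinnerWan2017, Thm. 3.3.1 (p. 11), §7.4.1 (pp. 30–31)] [cite: Skinner2016PacificMC, Thm. C (§1) and footnote 1] -/
theorem P2.openInputOnTreeOddAt_of_bsdp_of_locus_of_facts
    (hGZ : ∀ (N : ℕ) [NeZero N] (W : WeierstrassCurve ℚ) (K : Type) [Field K] [NumberField K],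
      gross_zagier N W K)
    (hKo : ∀ (N : ℕ) [NeZero N] (W : WeierstrassCurve ℚ) (K : Type) [Field K] [NumberField K],
      kolyvagin N W K)
    (hSk : Skinner2016.thmC_padicValRat_bsd_rank_zero)
    (hGZK : rank_eq_analyticRank_of_analyticRank_le_one) (hmod : hasEntireLFunction_rat)
    (hEP : ∀ (K : Type) [Field K] [NumberField K] (v : HeightOneSpectrum (𝓞 K)),
      localEulerPoincareCharacteristic (v.adicCompletion K))
    (hPTs : ∀ (K : Type) [Field K] [NumberField K], poitouTate_selmerStructure_duality K)
    (hPT2 : ∀ (K : Type) [Field K] [NumberField K], poitouTate_sha_tateDual K)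
    (hcd : fieldCdLE_two_of_numberField)
    (hX : ClassX11b W p) (hram : Ram W p) (htam : ¬ p ∣ W.tamagawaProduct) (hbsd : BSDp W p) :
    P2OpenInputOnTreeOddAt W p :=
  P2.openInputOnTreeOddAt_of_bsdp_of_ram W p hGZ hKo hSk hGZK hmod
    (p2ControlOnTree_odd_of_locus W p hKo hPTs hPT2 hEP hcd hX hram htam) hram hbsd

/-- **multr1-p2's gen-18 tightness at `p ≥ 5` with its control hypothesis discharged**: on the Locus
(`5 ≤ p`, (ram), `p ∤ ∏c`; class-wide 2 093 111 pairs) `P2OpenInputOnTreeAt W p ↔ BSDp W p` from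
published + cited facts ALONE. [cite: Castella2018, Thm. 2.3 (p. 5), Thm. 3.2 (p. 9)] [cite: Castella2018Erratum, (2.4) (p. 1)]
[cite: JetchevSkinnerWan2017, Thm. 3.3.1, §7.4.1–7.4.3 (pp. 30–31)] [cite: GreenbergLNM1716, §3 Lemma 3.3 (p. 87)] -/
theorem P2.openInputOnTreeAt_iff_bsdp_of_locus_of_facts
    (hGZ : ∀ (N : ℕ) [NeZero N] (W : WeierstrassCurve ℚ) (K : Type) [Field K] [NumberField K],
      gross_zagier N W K)
    (hKo : ∀ (N : ℕ) [NeZero N] (W : WeierstrassCurve ℚ) (K : Type) [Field K] [NumberField K],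
      kolyvagin N W K)
    (hB : ∀ (N : ℕ) [NeZero N] (W : WeierstrassCurve ℚ) (K : Type) [Field K] [NumberField K],
      Kolyvagin1990_padicValNat_card_sha_le N W K)
    (hSk : Skinner2016.thmC_padicValRat_bsd_rank_zero) (hWu : sha_dvd_analyticSha)
    (hGZK : rank_eq_analyticRank_of_analyticRank_le_one) (hmod : hasEntireLFunction_rat)
    (hnf : exists_isNewformOf) (hHL : HoffsteinLuo1997_exists_twist_L_one_ne_zero)
    (hMaz : mazur_not_dvd_maninConstant_of_odd)
    (hPT : ∀ (K : Type) [Field K] [NumberField K], poitouTate_sum_localTatePairing_eq_zero K)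
    (hEP : ∀ (K : Type) [Field K] [NumberField K] (v : HeightOneSpectrum (𝓞 K)),
      localEulerPoincareCharacteristic (v.adicCompletion K))
    (hPTs : ∀ (K : Type) [Field K] [NumberField K], poitouTate_selmerStructure_duality K)
    (hPT2 : ∀ (K : Type) [Field K] [NumberField K], poitouTate_sha_tateDual K)
    (hcd : fieldCdLE_two_of_numberField)
    (hX : ClassX11b W p) (hp5 : 5 ≤ p) (hram : Ram W p) (htam : ¬ p ∣ W.tamagawaProduct) :
    P2OpenInputOnTreeAt W p ↔ BSDp W p :=
  P2.openInputOnTreeAt_iff_bsdp_of_locus W p hGZ hKo hB hSk hWu hGZK hmod hnf hHL hMaz hPT hEP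
    (p2ControlOnTreeAt_of_locus W p hKo hPTs hPT2 hEP hcd hX hram htam) hX hp5 hram htam

end Tight

/-! ## §2. The `p = 3` rows (team x11b3, O2): atom A1, facts only -/

section Three

variable (W : WeierstrassCurve ℚ) [W.IsElliptic] [W.IsGloballyMinimal]

/-- **X11b@3 on atom A1 ((ram) ∧ `3 ∤ ∏_ℓ c_ℓ(E)`; census3: 248 943 class-pairs `N < 5·10⁵`, sweep
TRUE OPEN ∩ A1 = 1 116 of 1 684 classes) — THE open input at `(E,3)` ⟺ `BSD(E,3)` from published +
cited facts ALONE.** NOTHING in print or announced supplies the open input at `3`; X11b@3 stays OPEN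
(RESIDUAL-MAP §I O2); this says that on A1 the typed input is EXACTLY as strong as `BSD(E,3)` with
no auxiliary hypothesis. [cite: Castella2018, Thm. 2.3 (p. 5), Thm. 3.2 (p. 9)]
[cite: JetchevSkinnerWan2017, §2 (p. 6 L9 "p ≥ 3"), Thm. 3.3.1 (p. 11), §7.4.1–7.4.3 (pp. 30–31)]
[cite: GreenbergLNM1716, §3 Lemma 3.3 (p. 87)] [cite: Skinner2016PacificMC, Thm. C (§1) and footnote 1] [cite: Miller2011LMS, Def. 1.1] -/
theorem P2.openInputOnTreeOddAt_three_iff_bsdp_of_locus_of_facts [Fact (Nat.Prime 3)]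
    (hGZ : ∀ (N : ℕ) [NeZero N] (W : WeierstrassCurve ℚ) (K : Type) [Field K] [NumberField K],
      gross_zagier N W K)
    (hKo : ∀ (N : ℕ) [NeZero N] (W : WeierstrassCurve ℚ) (K : Type) [Field K] [NumberField K],
      kolyvagin N W K)
    (hB : ∀ (N : ℕ) [NeZero N] (W : WeierstrassCurve ℚ) (K : Type) [Field K] [NumberField K],
      Kolyvagin1990_padicValNat_card_sha_le N W K)
    (hSk : Skinner2016.thmC_padicValRat_bsd_rank_zero) (hWu : sha_dvd_analyticSha)
    (hGZK : rank_eq_analyticRank_of_analyticRank_le_one) (hmod : hasEntireLFunction_rat)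
    (hnf : exists_isNewformOf) (hHL : HoffsteinLuo1997_exists_twist_L_one_ne_zero)
    (hMaz : mazur_not_dvd_maninConstant_of_odd)
    (hPT : ∀ (K : Type) [Field K] [NumberField K], poitouTate_sum_localTatePairing_eq_zero K)
    (hEP : ∀ (K : Type) [Field K] [NumberField K] (v : HeightOneSpectrum (𝓞 K)),
      localEulerPoincareCharacteristic (v.adicCompletion K))
    (hPTs : ∀ (K : Type) [Field K] [NumberField K], poitouTate_selmerStructure_duality K)
    (hPT2 : ∀ (K : Type) [Field K] [NumberField K], poitouTate_sha_tateDual K)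
    (hcd : fieldCdLE_two_of_numberField)
    (hX : ClassX11b W 3) (hram : Ram W 3) (htam : ¬ 3 ∣ W.tamagawaProduct) :
    P2OpenInputOnTreeOddAt W 3 ↔ BSDp W 3 :=
  P2.openInputOnTreeOddAt_iff_bsdp_of_locus_of_facts W 3 hGZ hKo hB hSk hWu hGZK hmod hnf hHL hMaz hPT
    hEP hPTs hPT2 hcd hX hram htam

/-- **X11b@3 on a SEMISTABLE curve with `3 ∤ ∏_ℓ c_ℓ(E)` (census3: 100 315 class-pairs, A1 ∩
semistable) — THE open input ⟺ `BSD(E,3)` from published + cited facts ALONE** ((ram) automatic by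
Diamond's refined level-lowering `hLL`, `ram_of_semistable_of_irr_of_le_seven`).
[cite: Castella2018, Thm. 2.3 (p. 5), Thm. 3.2 (p. 9)] [cite: JetchevSkinnerWan2017, Thm. 3.3.1 (p. 11), §7.4.1–7.4.3 (pp. 30–31)]
[cite: GreenbergLNM1716, §3 Lemma 3.3 (p. 87)] [cite: Miller2011LMS, Def. 1.1] -/
theorem P2.openInputOnTreeOddAt_three_iff_bsdp_of_semistable_of_not_dvd_of_facts [Fact (Nat.Prime 3)]
    (hGZ : ∀ (N : ℕ) [NeZero N] (W : WeierstrassCurve ℚ) (K : Type) [Field K] [NumberField K],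
      gross_zagier N W K)
    (hKo : ∀ (N : ℕ) [NeZero N] (W : WeierstrassCurve ℚ) (K : Type) [Field K] [NumberField K],
      kolyvagin N W K)
    (hB : ∀ (N : ℕ) [NeZero N] (W : WeierstrassCurve ℚ) (K : Type) [Field K] [NumberField K],
      Kolyvagin1990_padicValNat_card_sha_le N W K)
    (hSk : Skinner2016.thmC_padicValRat_bsd_rank_zero) (hWu : sha_dvd_analyticSha)
    (hGZK : rank_eq_analyticRank_of_analyticRank_le_one) (hmod : hasEntireLFunction_rat)
    (hnf : exists_isNewformOf) (hHL : HoffsteinLuo1997_exists_twist_L_one_ne_zero)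
    (hMaz : mazur_not_dvd_maninConstant_of_odd)
    (hPT : ∀ (K : Type) [Field K] [NumberField K], poitouTate_sum_localTatePairing_eq_zero K)
    (hEP : ∀ (K : Type) [Field K] [NumberField K] (v : HeightOneSpectrum (𝓞 K)),
      localEulerPoincareCharacteristic (v.adicCompletion K))
    (hPTs : ∀ (K : Type) [Field K] [NumberField K], poitouTate_selmerStructure_duality K)
    (hPT2 : ∀ (K : Type) [Field K] [NumberField K], poitouTate_sha_tateDual K)
    (hcd : fieldCdLE_two_of_numberField)
    (hLL : Literature.NumberTheory.Automorphic.diamond1995_refinedSerre)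
    (hsst : Semistable W) (hX : ClassX11b W 3) (htam : ¬ 3 ∣ W.tamagawaProduct) :
    P2OpenInputOnTreeOddAt W 3 ↔ BSDp W 3 :=
  P2.openInputOnTreeOddAt_three_iff_bsdp_of_locus_of_facts W hGZ hKo hB hSk hWu hGZK hmod hnf hHL hMaz
    hPT hEP hPTs hPT2 hcd hX
    (ram_of_semistable_of_irr_of_le_seven hnf hLL W 3 hX.2.1 (by norm_num) hsst hX.2.2.2) htam

/-- **The team's typed STEP-L-at-3 conjecture `Three.StepLAt W` is EQUIVALENT to `BSD(E,3)` on the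
whole atom A1 (X11b@3 ∧ (ram) ∧ `3 ∤ ∏c`), from published + cited facts ALONE.** Reading for
CLASS-CLOSURE-PLAN §3.10 (E1/E2): on A1 statement discovery can neither weaken nor strengthen the
typed target, only find its SOURCE; every A1 pair with `BSD(E,3)` certified per pair is a pair where
`StepLAt` provably holds. CONDITIONAL bookkeeping; nothing booked; X11b@3 stays OPEN.
[cite: Castella2018, Thm. 2.3 (p. 5), Thm. 3.2 (p. 9)] [cite: JetchevSkinnerWan2017, Thm. 3.3.1 (p. 11), §7.4.1–7.4.3 (pp. 30–31)]
[cite: GreenbergLNM1716, §3 Lemma 3.3 (p. 87)] [cite: Miller2011LMS, Def. 1.1] -/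
theorem Three.stepLAt_iff_bsdp_of_locus
    (hGZ : ∀ (N : ℕ) [NeZero N] (W : WeierstrassCurve ℚ) (K : Type) [Field K] [NumberField K],
      gross_zagier N W K)
    (hKo : ∀ (N : ℕ) [NeZero N] (W : WeierstrassCurve ℚ) (K : Type) [Field K] [NumberField K],
      kolyvagin N W K)
    (hB : ∀ (N : ℕ) [NeZero N] (W : WeierstrassCurve ℚ) (K : Type) [Field K] [NumberField K],
      Kolyvagin1990_padicValNat_card_sha_le N W K)
    (hSk : Skinner2016.thmC_padicValRat_bsd_rank_zero) (hWu : sha_dvd_analyticSha)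
    (hGZK : rank_eq_analyticRank_of_analyticRank_le_one) (hmod : hasEntireLFunction_rat)
    (hnf : exists_isNewformOf) (hHL : HoffsteinLuo1997_exists_twist_L_one_ne_zero)
    (hMaz : mazur_not_dvd_maninConstant_of_odd)
    (hPT : ∀ (K : Type) [Field K] [NumberField K], poitouTate_sum_localTatePairing_eq_zero K)
    (hEP : ∀ (K : Type) [Field K] [NumberField K] (v : HeightOneSpectrum (𝓞 K)),
      localEulerPoincareCharacteristic (v.adicCompletion K))
    (hPTs : ∀ (K : Type) [Field K] [NumberField K], poitouTate_selmerStructure_duality K)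
    (hPT2 : ∀ (K : Type) [Field K] [NumberField K], poitouTate_sha_tateDual K)
    (hcd : fieldCdLE_two_of_numberField)
    (hX : ClassX11b W 3) (hram : Ram W 3) (htam : ¬ 3 ∣ W.tamagawaProduct) :
    Three.StepLAt W ↔ BSDp W 3 :=
  Three.stepLAt_iff_p2OpenInputOnTreeOddAt.trans
    (P2.openInputOnTreeOddAt_three_iff_bsdp_of_locus_of_facts W hGZ hKo hB hSk hWu hGZK hmod hnf hHL
      hMaz hPT hEP hPTs hPT2 hcd hX hram htam)

end Three

end Summit.BirchSwinnertonDyer.Rank1Residual.X11b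

end
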